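import Mathlib.FieldTheory.Separable
import Mathlib.FieldTheory.IsAlgClosed.Basic
import Mathlib.Algebra.MvPolynomial.Nilpotent
import Literature.NumberTheory.DiophantineGeometry.BertiniLineRestrictionProofs
import Literature.NumberTheory.DiophantineGeometry.BertiniSubstitutionProofs
import Literature.NumberTheory.DiophantineGeometry.BertiniResultantProofs
import Literature.NumberTheory.DiophantineGeometry.BertiniMinorProofs
import Literature.NumberTheory.DiophantineGeometry.BertiniDirectionProofs
import HarnessLib

/-!
# Separability of `f` on a good line: the discriminant `Res_T(G, ∂G/∂T)` of `G(T) = f(Z + Tv)`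

Second preparatory step of Kaltofen's effective Hilbert irreducibility theorem as used by
Cafure–Matera (2006, §3.2, proof of Thm. 3.3 and Cor. 3.4): for `f ∈ K[x₁, …, xₙ]` irreducible
of degree `δ` over the finite field `K = 𝔽_q` and a direction `v ∈ Kⁿ` with `f_δ(v) ≠ 0` and
`D_v f = Σ vᵢ ∂ᵢ f ≠ 0`,

* `irreducible_lineRestrict`: `G(T) = f(Z + Tv) ∈ K[Z][T]` is irreducible;
* `resultant_lineRestrict_derivative_ne_zero`: hence `P = Res_T(G, ∂G/∂T) ∈ K[Z]` is nonzero
  (over `K(Z)`, `G` irreducible of degree `δ` cannot divide `∂G/∂T ≠ 0`);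
* `totalDegree_resultant_lineRestrict_le`: `deg P ≤ (2δ - 1) δ` (a Sylvester determinant of
  size `2δ - 1` with entries of degree `≤ δ`);
* `exists_isCoprime_lineSpecialization`: if `(2δ - 1) δ < q` there is `μ ∈ Kⁿ` with `P(μ) ≠ 0`,
  i.e. `g_μ(T) = f(μ + Tv)` coprime to its derivative;
* `exists_root_derivative_ne_zero`: such a `g_μ` has a simple root in `K̄`.

## References

* E. Kaltofen, J. Comput. System Sci. 50 (1995) 274–295, §3. [Kaltofen1995]
* A. Cafure, G. Matera, Finite Fields Appl. 12 (2006) 155–185, §3.2. [CafureMatera2006]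
-/

noncomputable section

open scoped Classical Polynomial
open MvPolynomial

namespace Literature.NumberTheory.DiophantineGeometry

universe u v

variable {E : Type u} [Field E] {n : ℕ}

/-! ### Irreducibility descends along an injective base change -/

/-- If `f ⊗ L` is irreducible for a field extension `K → L` then `f` is irreducible. [folklore] -/
theorem irreducible_of_irreducible_mvPolynomial_map {L : Type v} [Field L] (σ : E →+* L)
    {τ : Type*} {f : MvPolynomial τ E} (h : Irreducible (MvPolynomial.map σ f)) :
    Irreducible f := by
  have hunit : ∀ a : MvPolynomial τ E, IsUnit (MvPolynomial.map σ a) → IsUnit a := by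
    intro a ha
    rw [MvPolynomial.isUnit_iff_totalDegree_of_isReduced] at ha ⊢
    refine ⟨?_, ?_⟩
    · rw [MvPolynomial.coeff_map] at ha
      refine isUnit_iff_ne_zero.2 fun h0 ↦ ?_
      rw [h0, map_zero] at ha
      exact not_isUnit_zero ha.1
    · rw [← totalDegree_map_of_injective a σ.injective]
      exact ha.2
  refine irreducible_iff.2 ⟨fun hu ↦ h.not_isUnit (hu.map (MvPolynomial.map σ)), fun a b hab ↦ ?_⟩
  rcases h.isUnit_or_isUnit (by rw [hab, map_mul]) with ha | hb
  · exact Or.inl (hunit a ha)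
  · exact Or.inr (hunit b hb)

/-! ### `G(T) = f(Z + Tv)` is irreducible -/

/-- **`G(T) = f(Z + Tv) ∈ E[Z][T]` is irreducible** for `f` irreducible: it is the affine shift
`f(W + Tv) ∈ E[T][W]` read in `E[W][T]`. [cite: CafureMatera2006, §3.2] -/
theorem irreducible_lineRestrict {f : MvPolynomial (Fin n) E} (hf : Irreducible f)
    (v : Fin n → E) :
    Irreducible (MvPolynomial.aeval
      (fun i ↦ Polynomial.C (X i) + Polynomial.C (C (v i)) * Polynomial.X :
        Fin n → Polynomial (MvPolynomial (Fin n) E)) f) := by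
  set Ψ := (optionEquivRight E (Fin n)).symm.trans (optionEquivLeft E (Fin n)) with hΨ
  have h : MvPolynomial.aeval
      (fun i ↦ Polynomial.C (X i) + Polynomial.C (C (v i)) * Polynomial.X :
        Fin n → Polynomial (MvPolynomial (Fin n) E)) f =
      Ψ (MvPolynomial.aeval (fun i ↦ C (Polynomial.C (v i) * Polynomial.X) + X i :
        Fin n → MvPolynomial (Fin n) E[X]) f) := by
    have h1 : ((MvPolynomial.aeval
        (fun i ↦ Polynomial.C (X i) + Polynomial.C (C (v i)) * Polynomial.X :
          Fin n → Polynomial (MvPolynomial (Fin n) E)) :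
            MvPolynomial (Fin n) E →ₐ[E] Polynomial (MvPolynomial (Fin n) E)) :
              MvPolynomial (Fin n) E →+* Polynomial (MvPolynomial (Fin n) E)) =
        (Ψ.toAlgHom : MvPolynomial (Fin n) E[X] →+* (MvPolynomial (Fin n) E)[X]).comp
          ((MvPolynomial.aeval (fun i ↦ C (Polynomial.C (v i) * Polynomial.X) + X i :
            Fin n → MvPolynomial (Fin n) E[X]) :
              MvPolynomial (Fin n) E →ₐ[E] MvPolynomial (Fin n) E[X]) :
                MvPolynomial (Fin n) E →+* MvPolynomial (Fin n) E[X]) := by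
      refine MvPolynomial.ringHom_ext (fun e ↦ ?_) (fun i ↦ ?_)
      · simp only [RingHom.coe_coe, RingHom.coe_comp, Function.comp_apply]
        rw [MvPolynomial.aeval_C, MvPolynomial.aeval_C, Polynomial.algebraMap_apply,
          MvPolynomial.algebraMap_eq, MvPolynomial.algebraMap_apply, Polynomial.algebraMap_eq]
        change _ = Ψ (C (Polynomial.C e))
        rw [optionEquiv_C, Polynomial.map_C]
      · simp only [RingHom.coe_coe, aeval_X, RingHom.coe_comp, Function.comp_apply, map_add]
        change _ = Ψ (C _) + Ψ (X i)
        rw [optionEquiv_C, optionEquiv_X, Polynomial.map_mul, Polynomial.map_C,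
          Polynomial.map_X, add_comm]
    exact DFunLike.congr_fun h1 f
  rw [h, MulEquiv.irreducible_iff Ψ]
  exact irreducible_affineShift hf _

/-! ### The discriminant `Res_T(G, ∂G/∂T)` is nonzero -/

/-- **`Res_T(G, ∂G/∂T) ≠ 0`** for `G(T) = f(Z + Tv)` with `f` irreducible, `f_δ(v) ≠ 0` and
`D_v f ≠ 0`: over `K(Z)`, `G` is irreducible of exact degree `δ` (its leading coefficient
`f_δ(v)` is a unit), so it cannot share a factor with `∂G/∂T ≠ 0` of degree `< δ`.
[cite: CafureMatera2006, §3.2] [cite: Kaltofen1995, §3] -/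
theorem resultant_lineRestrict_derivative_ne_zero {f : MvPolynomial (Fin n) E}
    (hf : Irreducible f) {v : Fin n → E}
    (hv : MvPolynomial.eval v (homogeneousComponent f.totalDegree f) ≠ 0)
    (hD : (∑ i, C (v i) * pderiv i f) ≠ 0) :
    Polynomial.resultant
      (MvPolynomial.aeval
        (fun i ↦ Polynomial.C (X i) + Polynomial.C (C (v i)) * Polynomial.X :
          Fin n → Polynomial (MvPolynomial (Fin n) E)) f)
      (Polynomial.derivative (MvPolynomial.aeval
        (fun i ↦ Polynomial.C (X i) + Polynomial.C (C (v i)) * Polynomial.X :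
          Fin n → Polynomial (MvPolynomial (Fin n) E)) f))
      f.totalDegree (f.totalDegree - 1) ≠ 0 := by
  set δ := f.totalDegree with hδ
  set G := MvPolynomial.aeval
    (fun i ↦ Polynomial.C (X i) + Polynomial.C (C (v i)) * Polynomial.X :
      Fin n → Polynomial (MvPolynomial (Fin n) E)) f with hG
  -- `δ ≥ 1` since `D_v f ≠ 0`
  have hδ1 : 1 ≤ δ := by
    by_contra h0
    have h0' : f.totalDegree = 0 := by omega
    rw [totalDegree_eq_zero_iff_eq_C] at h0'
    apply hD
    rw [h0']
    simp
  have hcoeff : G.coeff δ = C (MvPolynomial.eval v (homogeneousComponent δ f)) :=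
    coeff_lineRestrict_totalDegree f v
  have hdegle : G.natDegree ≤ δ := natDegree_lineRestrict_le f v
  have hcoeff0 : G.coeff δ ≠ 0 := by
    rw [hcoeff]
    exact (MvPolynomial.C_eq_zero.not).2 hv
  have hdeg : G.natDegree = δ := le_antisymm hdegle (Polynomial.le_natDegree_of_ne_zero hcoeff0)
  have hu : IsUnit G.leadingCoeff := by
    rw [Polynomial.leadingCoeff, hdeg, hcoeff]
    exact (isUnit_iff_ne_zero.2 hv).map C
  have hirrG : Irreducible G := irreducible_lineRestrict hf v
  have hG'0 : Polynomial.derivative G ≠ 0 := fun h0 ↦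
    hD (sum_C_mul_pderiv_eq_zero_of_derivative_lineRestrict v h0)
  have hG'deg : (Polynomial.derivative G).natDegree ≤ δ - 1 :=
    (Polynomial.natDegree_derivative_le G).trans (by rw [hdeg])
  intro hres
  -- pass to the fraction field `L = E(Z)`
  set L := FractionRing (MvPolynomial (Fin n) E) with hL
  have hinj : Function.Injective (algebraMap (MvPolynomial (Fin n) E) L) :=
    IsFractionRing.injective _ _
  have hmap := Polynomial.resultant_map_map G (Polynomial.derivative G) δ (δ - 1)
    (algebraMap (MvPolynomial (Fin n) E) L)
  rw [hres, map_zero] at hmap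
  set G₁ := G.map (algebraMap (MvPolynomial (Fin n) E) L) with hG₁
  set G₁' := (Polynomial.derivative G).map (algebraMap (MvPolynomial (Fin n) E) L) with hG₁'
  have hG₁'0 : G₁' ≠ 0 := (Polynomial.map_ne_zero_iff hinj).2 hG'0
  have hG₁deg : G₁.natDegree = δ := by
    rw [hG₁, Polynomial.natDegree_map_eq_of_injective hinj, hdeg]
  have hG₁'deg : G₁'.natDegree ≤ δ - 1 := by
    rw [hG₁', Polynomial.natDegree_map_eq_of_injective hinj]
    exact hG'deg
  obtain ⟨k, hk⟩ : ∃ k, δ - 1 = G₁'.natDegree + k := ⟨δ - 1 - G₁'.natDegree, by omega⟩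
  rw [hk, Polynomial.resultant_add_right_deg _ _ _ _ k le_rfl] at hmap
  have hG₁0 : G₁ ≠ 0 := fun h0 ↦ by rw [h0, Polynomial.natDegree_zero] at hG₁deg; omega
  have hlc : G₁.coeff δ ≠ 0 := by
    rw [← hG₁deg, Polynomial.coeff_natDegree]
    exact Polynomial.leadingCoeff_ne_zero.2 hG₁0
  have hres0 : Polynomial.resultant G₁ G₁' δ G₁'.natDegree = 0 :=
    (mul_eq_zero.1 hmap).resolve_left (pow_ne_zero _ hlc)
  rw [← hG₁deg] at hres0
  have hncop : ¬ IsCoprime G₁ G₁' := (Polynomial.resultant_eq_zero_iff.1 hres0).2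
  have hirrL : Irreducible G₁ := irreducible_map_fractionRing_of_isUnit_leadingCoeff hirrG hu
  have hdvd : G₁ ∣ G₁' := by
    by_contra hnd
    exact hncop (hirrL.coprime_iff_not_dvd.2 hnd)
  have := Polynomial.natDegree_le_of_dvd hdvd hG₁'0
  omega

/-! ### Degree of the discriminant -/

/-- Entries of a Sylvester matrix over `E[Z]` have total degree bounded by that of the
coefficients. [folklore] -/
theorem totalDegree_sylvester_le {σ : Type v} (F G : Polynomial (MvPolynomial σ E)) (m k e : ℕ)
    (hF : ∀ i, (F.coeff i).totalDegree ≤ e) (hG : ∀ i, (G.coeff i).totalDegree ≤ e)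
    (i j : Fin (m + k)) : (Polynomial.sylvester F G m k i j).totalDegree ≤ e := by
  induction j using Fin.addCases with
  | left j =>
    simp only [Polynomial.sylvester, Matrix.of_apply, Fin.addCases_left]
    split_ifs <;> simp [hG]
  | right j =>
    simp only [Polynomial.sylvester, Matrix.of_apply, Fin.addCases_right]
    split_ifs <;> simp [hF]

/-- **Degree of a resultant over `E[Z]`:** coefficients of total degree `≤ e` give
`deg Res^{m,k}(F, G) ≤ (m + k) e`. [folklore] -/
theorem totalDegree_resultant_le {σ : Type v} (F G : Polynomial (MvPolynomial σ E)) (m k e : ℕ)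
    (hF : ∀ i, (F.coeff i).totalDegree ≤ e) (hG : ∀ i, (G.coeff i).totalDegree ≤ e) :
    (Polynomial.resultant F G m k).totalDegree ≤ (m + k) * e := by
  rw [Polynomial.resultant]
  have := totalDegree_det_le_sum (Polynomial.sylvester F G m k) (fun _ ↦ e)
    (fun i j ↦ totalDegree_sylvester_le F G m k e hF hG i j)
  simp only [Finset.sum_const, Finset.card_univ, Fintype.card_fin, smul_eq_mul] at this
  convert this
  all_goals rfl

/-- The `T`-coefficients of `∂G/∂T` have `Z`-degree `≤ δ` as well. [folklore] -/
theorem totalDegree_coeff_derivative_lineRestrict_le (f : MvPolynomial (Fin n) E)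
    (v : Fin n → E) (k : ℕ) :
    ((Polynomial.derivative (MvPolynomial.aeval
      (fun i ↦ Polynomial.C (X i) + Polynomial.C (C (v i)) * Polynomial.X :
        Fin n → Polynomial (MvPolynomial (Fin n) E)) f)).coeff k).totalDegree ≤
      f.totalDegree := by
  rw [Polynomial.coeff_derivative]
  refine (totalDegree_mul _ _).trans ?_
  have hc : ((k : MvPolynomial (Fin n) E) + 1) = C ((k : E) + 1) := by
    rw [map_add, map_natCast, map_one]
  rw [hc, totalDegree_C, add_zero]
  exact totalDegree_coeff_lineRestrict_le f v (k + 1)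

/-- **`deg Res_T(G, ∂G/∂T) ≤ (2δ - 1) δ`.** [cite: CafureMatera2006, §3.2] -/
theorem totalDegree_resultant_lineRestrict_le (f : MvPolynomial (Fin n) E) (v : Fin n → E) :
    (Polynomial.resultant
      (MvPolynomial.aeval
        (fun i ↦ Polynomial.C (X i) + Polynomial.C (C (v i)) * Polynomial.X :
          Fin n → Polynomial (MvPolynomial (Fin n) E)) f)
      (Polynomial.derivative (MvPolynomial.aeval
        (fun i ↦ Polynomial.C (X i) + Polynomial.C (C (v i)) * Polynomial.X :
          Fin n → Polynomial (MvPolynomial (Fin n) E)) f))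
      f.totalDegree (f.totalDegree - 1)).totalDegree ≤
      (f.totalDegree + (f.totalDegree - 1)) * f.totalDegree :=
  totalDegree_resultant_le _ _ _ _ _ (totalDegree_coeff_lineRestrict_le f v)
    (totalDegree_coeff_derivative_lineRestrict_le f v)

/-! ### A base point `μ` with `f(μ + Tv)` separable -/

/-- **Existence of a good base point** (Cafure–Matera, proof of Cor. 3.4 / Thm. 5.4): for
`f ∈ 𝔽_q[x₁,…,xₙ]` irreducible of degree `δ`, a direction `v` with `f_δ(v) ≠ 0` and `D_v f ≠ 0`,
and `(2δ - 1) δ < q`, there is `μ ∈ 𝔽_qⁿ` such that `g_μ(T) = f(μ + Tv)` is coprime to its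
derivative. [cite: CafureMatera2006, §3.2 and proof of Thm. 5.4] -/
theorem exists_isCoprime_lineSpecialization {K : Type u} [Field K] [Fintype K] {n : ℕ}
    {f : MvPolynomial (Fin n) K} (hf : Irreducible f) {v : Fin n → K}
    (hv : MvPolynomial.eval v (homogeneousComponent f.totalDegree f) ≠ 0)
    (hD : (∑ i, C (v i) * pderiv i f) ≠ 0)
    (hq : (f.totalDegree + (f.totalDegree - 1)) * f.totalDegree < Fintype.card K) :
    ∃ μ : Fin n → K, IsCoprime
      (MvPolynomial.aeval
        (fun i ↦ Polynomial.C (μ i) + Polynomial.C (v i) * Polynomial.X : Fin n → K[X]) f)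
      (Polynomial.derivative (MvPolynomial.aeval
        (fun i ↦ Polynomial.C (μ i) + Polynomial.C (v i) * Polynomial.X : Fin n → K[X]) f)) := by
  set δ := f.totalDegree with hδ
  set G := MvPolynomial.aeval
    (fun i ↦ Polynomial.C (X i) + Polynomial.C (C (v i)) * Polynomial.X :
      Fin n → Polynomial (MvPolynomial (Fin n) K)) f with hG
  set P := Polynomial.resultant G (Polynomial.derivative G) δ (δ - 1) with hP
  have hP0 : P ≠ 0 := resultant_lineRestrict_derivative_ne_zero hf hv hD
  have hPdeg : P.totalDegree < Fintype.card K :=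
    (totalDegree_resultant_lineRestrict_le f v).trans_lt hq
  obtain ⟨μ, hμ⟩ := exists_eval_ne_zero_of_totalDegree_lt_card hP0 hPdeg
  refine ⟨μ, ?_⟩
  set g := MvPolynomial.aeval
    (fun i ↦ Polynomial.C (μ i) + Polynomial.C (v i) * Polynomial.X : Fin n → K[X]) f with hg
  have hδ1 : 1 ≤ δ := by
    by_contra h0
    have h0' : f.totalDegree = 0 := by omega
    rw [totalDegree_eq_zero_iff_eq_C] at h0'
    apply hD
    rw [h0']
    simp
  -- `P(μ) = Res(g, g')`
  have hmapG : G.map (MvPolynomial.eval μ) = g := map_eval_lineRestrict f μ v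
  have hmapG' : (Polynomial.derivative G).map (MvPolynomial.eval μ) = Polynomial.derivative g := by
    rw [← Polynomial.derivative_map, hmapG]
  have hres : Polynomial.resultant g (Polynomial.derivative g) δ (δ - 1) =
      MvPolynomial.eval μ P := by
    rw [← hmapG', ← hmapG, Polynomial.resultant_map_map]
  have hgdeg : g.natDegree ≤ δ := natDegree_map_eval_lineRestrict_le f μ v
  have hg'deg : (Polynomial.derivative g).natDegree ≤ δ - 1 :=
    (Polynomial.natDegree_derivative_le g).trans (Nat.sub_le_sub_right hgdeg 1)
  obtain ⟨p, q, -, -, hpq⟩ := Polynomial.exists_mul_add_mul_eq_C_resultant g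
    (Polynomial.derivative g) hgdeg hg'deg (Or.inl (by omega))
  rw [hres] at hpq
  set r := MvPolynomial.eval μ P with hr
  refine ⟨Polynomial.C r⁻¹ * p, Polynomial.C r⁻¹ * q, ?_⟩
  calc Polynomial.C r⁻¹ * p * g + Polynomial.C r⁻¹ * q * Polynomial.derivative g
      = Polynomial.C r⁻¹ * (g * p + Polynomial.derivative g * q) := by ring
    _ = 1 := by rw [hpq, ← Polynomial.C_mul, inv_mul_cancel₀ hμ, Polynomial.C_1]

/-! ### A simple root over the algebraic closure -/

/-- A polynomial of positive degree coprime to its derivative has a simple root in any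
algebraically closed extension. [folklore] -/
theorem exists_root_derivative_ne_zero {K : Type u} [Field K] {L : Type v} [Field L]
    [IsAlgClosed L] (σ : K →+* L) {g : K[X]} (hcop : IsCoprime g (Polynomial.derivative g))
    (hdeg : g.natDegree ≠ 0) :
    ∃ α : L, (g.map σ).eval α = 0 ∧ (Polynomial.derivative (g.map σ)).eval α ≠ 0 := by
  have hsep : g.Separable := (Polynomial.separable_def g).2 hcop
  have hg0 : g ≠ 0 := fun h ↦ hdeg (by rw [h, Polynomial.natDegree_zero])
  have hdeg' : (g.map σ).degree ≠ 0 := by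
    rw [Polynomial.degree_map, Polynomial.degree_eq_natDegree hg0]
    exact_mod_cast hdeg
  obtain ⟨α, hα⟩ := IsAlgClosed.exists_root (g.map σ) hdeg'
  refine ⟨α, hα, ?_⟩
  rw [Polynomial.derivative_map, Polynomial.eval_map]
  refine hsep.eval₂_derivative_ne_zero σ ?_
  rw [← Polynomial.eval_map]
  exact hα

end Literature.NumberTheory.DiophantineGeometry
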